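import Summits.BirchSwinnertonDyer.Rank1Residual.Additive.TypeGThreeTowerOfSurj
import Summits.BirchSwinnertonDyer.Rank1Residual.GaloisImage.WildThreeCubeRootTower
import Summits.BirchSwinnertonDyer.Rank1Residual.GaloisImage.WildThreeCubeRootResidue
import HarnessLib

/-!
# The EXOTIC residue of X4 at `3` avoids the CUBE-ROOT ROWS of n1011-p02's
# `GaloisImage/WildThreeCubeRootTower.lean` (p274467) — class side of T-b11 ARM A's family (A)
# (cell `b2b-bsdres`, team n1011, seat p14 gen 3, OWNERS row T-b11 ARM B 'EXOTIC core at m = 3')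

HONEST FRAMING (cell `b2b-bsdres`, run/shared/lean/b2b/bsd-rank1-residual/, verbatim in every
file): the goal of the cell is to DELETE the COMBINATION-SHAPED residual classes of the
Birch–Swinnerton-Dyer formula for ALL analytic-rank `≤ 1` elliptic curves over `ℚ` — "full BSD
formula for every rank `≤ 1` curve in class `C`" assembled STRICTLY from published theorems — so
that the rank-`≤ 1` remainder becomes exactly the CONSTRUCTION-SHAPED classes, which are TYPED
(missing-input `Prop`s), NOT attempted. This is not "finishing BSD". Team n1011 (N10 / N11, the
additive block X4 ∧ `p = 3`): research route; no claim beyond the stated classes; the label X4 is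
UNCHANGED by this file; nothing is booked. Theorems only (no definition, no named fact minted; every
published input of the end-state is an explicit named-fact hypothesis, as in p250513 / p251574).

## What this file proves

n1011-p02's binder-free tower `towerSurj_three_of_surj_of_cubeRoot` (T-b11 ARM A, file F3c): for
any model with `v₃(c₄) = n₄`, `v₃(c₆) = n₆`, `v₃(Δ) = n_Δ` (naturals), `2n₆ = n_Δ + 3`
(`v₃(j − 1728) = 3`), `n_Δ + 6 ≤ 3n₄` (`v₃ j ≥ 6`), `3 ∣ n₆`, and a rational `c` with
`c³Δ/(2c₆) − 1 = 0` or `v₃(c³Δ/(2c₆) − 1) ≥ 2`, `ρ̄_{E,3}` onto forces the whole `3`-adic tower.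
Read contrapositively on the class side:

* `ClassX4.not_cubeRootRow_of_not_towerSurj_three` — an EXOTIC X4 pair at `3` (surj(3), tower
  failing) is NOT a cube-root row: for every choice of digits `n₄ n₆ n_Δ` matching `c₄, c₆, Δ` with
  `2n₆ = n_Δ + 3`, `n_Δ + 6 ≤ 3n₄`, `3 ∣ n₆`, no rational `c` satisfies the cube condition;
* `exotic_iff_exotic_of_notCubeRootRow` — p251574's EXOTIC piece (`p = 3`, `r_an = 0`, X4,
  surj(3), `ord₃ j ≥ 0`, `¬ TypeG W 3`, tower fails ⟹ upper) is EQUIVALENT to the same statement on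
  the rows that are not cube-root rows;
* END-STATE **`x4SharpUnitFree_iff_lower_and_residues_sharp_exoticNotCubeRoot_noL20`** — the
  eight-fact X4 end-state with the EXOTIC piece so restricted.  (Independent of, and composable
  with, the `v₃(j − 1728) = 3` / wild-`E[3]` restrictions of `Additive/X4ExoticThree.lean` p268581
  and its sequel; the restrictions are conjoined row by row.)

Census reading (EVIDENCE, rmap-2 GEN 18 `§D addendum 18`, zero-compute join on the 341
`r_an = 0` EXOTIC-candidate cells; `HOME/b2b-bsdres-n1011-p14/e11/EXO3-LOCAL-WITNESS.md` §11):
exactly 60 cells are cube-root rows (all `f₃ = 3`, `v₃ j ≥ 6`, `c₆/3^{n₆} ≡ ±2 mod 9`, every one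
with a degree-27 local orbit of `9`-torsion abscissae) — theorem rows by p274467; 0 of the 20
Elkies cells is one.  Nothing booked; X4 CONSTRUCTION-SHAPED; no label change.

References: [SerreLocalFields1979] I §7; [Serre1972] §5.3; [SerreAbelianLadic1968] IV-23 Lemma 3;
[Elkies2006]; [Kato2004Asterisque] Thm. 14.5 (3).
-/

noncomputable section

open scoped Classical

open WeierstrassCurve Literature.NumberTheory.EllipticCurves
  Literature.NumberTheory.EllipticCurves.ModularForms
  Literature.NumberTheory.EllipticCurves.Rank1Residual
  Literature.NumberTheory.EllipticCurves.Rank1Residual.Typed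
  Summit.BirchSwinnertonDyer.Rank1Residual.GaloisImage

namespace Summit.BirchSwinnertonDyer.Rank1Residual.Additive

section NotCubeRoot

variable {W : WeierstrassCurve ℚ} [W.IsElliptic] [W.IsGloballyMinimal]

omit [W.IsGloballyMinimal] in
/-- **An EXOTIC X4 pair at `3` is not a cube-root row** (contrapositive of n1011-p02's
`towerSurj_three_of_surj_of_cubeRoot`): with `ρ̄_{E,3}` onto and the `3`-adic tower failing, no
digits `n₄ n₆ n_Δ` of `c₄, c₆, Δ` with `2n₆ = n_Δ + 3`, `n_Δ + 6 ≤ 3n₄`, `3 ∣ n₆` admit a rational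
`c` with `c³Δ/(2c₆) − 1 = 0` or `v₃(c³Δ/(2c₆) − 1) ≥ 2`.
[cite: SerreLocalFields1979, Ch. I §7 Cor. to Prop. 21 and Prop. 22(b)] [cite: Serre1972, §5.3]
[cite: SerreAbelianLadic1968, Ch. IV §3.4, Lemma 3 (IV-23)] -/
theorem ClassX4.not_cubeRootRow_of_not_towerSurj_three [Fact (Nat.Prime 3)] (_hX : ClassX4 W 3)
    (hsurj : Surj W 3) (hnot : ¬ ∀ n : ℕ, W.HasSurjectiveModNGaloisRep (3 ^ n : ℕ))
    {n₄ n₆ nΔ : ℕ} (hc₄ : padicValRat 3 W.c₄ = n₄) (hc₆ : padicValRat 3 W.c₆ = n₆)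
    (hΔ : padicValRat 3 W.Δ = nΔ) (hm : 2 * n₆ = nΔ + 3) (hj : nΔ + 6 ≤ 3 * n₄) (h3 : 3 ∣ n₆)
    (c : ℚ) :
    ¬ (c ^ 3 * W.Δ / (2 * W.c₆) - 1 = 0 ∨
      (2 : ℤ) ≤ padicValRat 3 (c ^ 3 * W.Δ / (2 * W.c₆) - 1)) := fun hc ↦
  hnot (towerSurj_three_of_surj_of_cubeRoot W hsurj hc₄ hc₆ hΔ hm hj h3 ⟨c, hc⟩)

end NotCubeRoot

/-! ### The X4 end-state with the EXOTIC piece off the cube-root rows -/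

/-- **The EXOTIC hypothesis RESTRICTED to the non-cube-root rows.**  p251574's EXOTIC piece is
EQUIVALENT to the same statement on the rows which, for every admissible digit triple, carry no
rational `c` with the cube condition of `WildThreeCubeRootTower`. [cite: Wuthrich2014, Lemma 20 (p. 399)]
[cite: SerreAbelianLadic1968, Ch. IV §3.4, Lemma 3 (IV-23)] [cite: Serre1972, §5.3] -/
theorem exotic_iff_exotic_of_notCubeRootRow :
    (∀ (W : WeierstrassCurve ℚ) [W.IsElliptic] [W.IsGloballyMinimal],
        W.analyticRank = 0 → ClassX4 W 3 → Surj W 3 → 0 ≤ padicValRat 3 W.j → ¬ TypeG W 3 →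
        ¬ (∀ n : ℕ, W.HasSurjectiveModNGaloisRep (3 ^ n : ℕ)) → MissingUpperBoundAt W 3) ↔
    (∀ (W : WeierstrassCurve ℚ) [W.IsElliptic] [W.IsGloballyMinimal],
        W.analyticRank = 0 → ClassX4 W 3 → Surj W 3 → 0 ≤ padicValRat 3 W.j → ¬ TypeG W 3 →
        (∀ (n₄ n₆ nΔ : ℕ), padicValRat 3 W.c₄ = n₄ → padicValRat 3 W.c₆ = n₆ →
          padicValRat 3 W.Δ = nΔ → 2 * n₆ = nΔ + 3 → nΔ + 6 ≤ 3 * n₄ → 3 ∣ n₆ →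
          ∀ c : ℚ, ¬ (c ^ 3 * W.Δ / (2 * W.c₆) - 1 = 0 ∨
            (2 : ℤ) ≤ padicValRat 3 (c ^ 3 * W.Δ / (2 * W.c₆) - 1))) →
        ¬ (∀ n : ℕ, W.HasSurjectiveModNGaloisRep (3 ^ n : ℕ)) → MissingUpperBoundAt W 3) := by
  haveI : Fact (Nat.Prime 3) := ⟨Nat.prime_three⟩
  constructor
  · intro h V _ _ hr hX hs hj hG _ hnot
    exact h V hr hX hs hj hG hnot
  · intro h V _ _ hr hX hs hj hG hnot
    exact h V hr hX hs hj hG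
      (fun n₄ n₆ nΔ hc₄ hc₆ hΔ hm hj6 h3 c ↦
        ClassX4.not_cubeRootRow_of_not_towerSurj_three hX hs hnot hc₄ hc₆ hΔ hm hj6 h3 c)
      hnot

/-- **THE END-STATE OF CLASS X4 ON EIGHT NAMED FACTS with the EXOTIC piece OFF THE CUBE-ROOT
ROWS: X4♯(unit-free) ⟺ LOWER ∧ EXOTIC(`ord₃ j ≥ 0` ∧ `¬ TypeG` ∧ not a cube-root row) ∧
TAM-DEFECT₂♭ ∧ ODD-SHA♭ ∧ MANIN♭** — p251574's `…exoticTypeG_noL20` rewritten along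
`exotic_iff_exotic_of_notCubeRootRow`.  No named fact beyond the eight; X4 stays
CONSTRUCTION-SHAPED; nothing booked. [cite: Kato2004Asterisque, Thm. 14.5 (3) (p. 236), Thm. 17.4 (3) (p. 273)]
[cite: Delbourgo1998, Prop. 4 (p. 144)] [cite: Wuthrich2014, Lemma 20 (p. 399)] [cite: SilvermanAEC2009, Thm. X.4.14]
[cite: Kim2022StructureSelmer, Conj. 1.10 (PDF p. 8)] [cite: Miller2011LMS, Def. 1.1] [cite: Serre1972, §5.3] -/
theorem x4SharpUnitFree_iff_lower_and_residues_sharp_exoticNotCubeRoot_noL20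
    (hCT : exists_casselsTate_pairing (K := ℚ))
    (hKatoS : Kato2004.rankZero_padicValNat_sha_le_sub_localTamagawa_of_additive_potGood_of_imageContainsSL2)
    (hDel : Delbourgo1998.prop4_rankZero_pow_dvd_constantCoeff)
    (hGZK : rank_eq_analyticRank_of_analyticRank_le_one) (hmod : hasEntireLFunction_rat)
    (hmodD : nonempty_modularParametrizationData)
    (hKatoχ : Wuthrich2014.kato_halfEigenCharIdeal_dvd_cyclotomicPrime_of_surjective)
    (hK : Kato2004.charIdeal_dvd_padicLFunctionBranch_component_of_surjective) :
    X4SharpUnitFree ↔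
      (∀ (W : WeierstrassCurve ℚ) [W.IsElliptic] [W.IsGloballyMinimal] (p : ℕ) [Fact p.Prime],
          W.analyticRank = 0 → ClassX4 W p → Surj W p → MissingLowerBoundAt W p) ∧
      (∀ (W : WeierstrassCurve ℚ) [W.IsElliptic] [W.IsGloballyMinimal],
          W.analyticRank = 0 → ClassX4 W 3 → Surj W 3 → 0 ≤ padicValRat 3 W.j → ¬ TypeG W 3 →
          (∀ (n₄ n₆ nΔ : ℕ), padicValRat 3 W.c₄ = n₄ → padicValRat 3 W.c₆ = n₆ →
            padicValRat 3 W.Δ = nΔ → 2 * n₆ = nΔ + 3 → nΔ + 6 ≤ 3 * n₄ → 3 ∣ n₆ →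
            ∀ c : ℚ, ¬ (c ^ 3 * W.Δ / (2 * W.c₆) - 1 = 0 ∨
              (2 : ℤ) ≤ padicValRat 3 (c ^ 3 * W.Δ / (2 * W.c₆) - 1))) →
          ¬ (∀ n : ℕ, W.HasSurjectiveModNGaloisRep (3 ^ n : ℕ)) → MissingUpperBoundAt W 3) ∧
      (∀ (W : WeierstrassCurve ℚ) [W.IsElliptic] [W.IsGloballyMinimal] (p : ℕ) [Fact p.Prime],
          W.analyticRank = 0 → ClassX4 W p → Surj W p → 0 ≤ padicValRat p W.j →
          ¬ (TypeGOrd W p ∧ semistabilityIndex W p = 2) →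
          padicValNat p ((W.baseChange ℚ_[p]).localTamagawaNumber ℤ_[p]) + 2 ≤
            padicValNat p W.tamagawaProduct →
          MissingUpperBoundAt W p) ∧
      (∀ (W : WeierstrassCurve ℚ) [W.IsElliptic] [W.IsGloballyMinimal] (p : ℕ) [Fact p.Prime],
          W.analyticRank = 0 → ClassX4 W p → Surj W p → 0 ≤ padicValRat p W.j →
          ¬ (TypeGOrd W p ∧ semistabilityIndex W p = 2) →
          (∃ q : ℚ, shaAn W = (q : ℂ) ∧ Odd (padicValRat p q)) → MissingUpperBoundAt W p) ∧
      (∀ (W : WeierstrassCurve ℚ) [W.IsElliptic] [W.IsGloballyMinimal] (p : ℕ) [Fact p.Prime],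
          W.analyticRank = 0 → ClassX4 W p → Surj W p → 0 ≤ padicValRat p W.j →
          ¬ (TypeGOrd W p ∧ semistabilityIndex W p = 2) →
          (∀ (N : ℕ) [NeZero N] (D : ModularParametrizationData W N), (p : ℤ) ∣ D.maninConstant) →
          MissingUpperBoundAt W p) := by
  rw [x4SharpUnitFree_iff_lower_and_residues_sharp_exoticTypeG_noL20 hCT hKatoS hDel hGZK hmod hmodD
    hKatoχ hK, exotic_iff_exotic_of_notCubeRootRow]

/-! ### Appendix (gen 3, after n1011-p02's F3d p278541 `GaloisImage/WildThreeCubeRootResidue.lean`):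
the same restriction in CENSUS DIGITS — the residue rows `c₆/3^{v₃ c₆} ≡ ±2 (mod 9)` -/

section Residue

variable {W : WeierstrassCurve ℚ} [W.IsElliptic] [W.IsGloballyMinimal]

omit [W.IsGloballyMinimal] in
/-- **An EXOTIC X4 pair at `3` is not a `c₆`-residue row** (contrapositive of n1011-p02's
`towerSurj_three_of_surj_of_c₆_residue`, the census-digit form of the cube-root rows): with
`ρ̄_{E,3}` onto and the `3`-adic tower failing, no digits `n₄ n₆ n_Δ` of `c₄, c₆, Δ` with
`2n₆ = n_Δ + 3`, `n_Δ + 6 ≤ 3n₄`, `3 ∣ n₆` and no sign `s = ±1` satisfy `c₆/3^{n₆} − 2s = 0` or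
`v₃(c₆/3^{n₆} − 2s) ≥ 2` (i.e. `c₆/3^{v₃ c₆} ≢ ±2 mod 9`).
[cite: SerreLocalFields1979, Ch. I §7 Cor. to Prop. 21 and Prop. 22(b)] [cite: Serre1972, §5.3]
[cite: SerreAbelianLadic1968, Ch. IV §3.4, Lemma 3 (IV-23)] -/
theorem ClassX4.not_c₆Residue_of_not_towerSurj_three [Fact (Nat.Prime 3)] (_hX : ClassX4 W 3)
    (hsurj : Surj W 3) (hnot : ¬ ∀ n : ℕ, W.HasSurjectiveModNGaloisRep (3 ^ n : ℕ))
    {n₄ n₆ nΔ : ℕ} (hc₄ : padicValRat 3 W.c₄ = n₄) (hc₆ : padicValRat 3 W.c₆ = n₆)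
    (hΔ : padicValRat 3 W.Δ = nΔ) (hm : 2 * n₆ = nΔ + 3) (hj : nΔ + 6 ≤ 3 * n₄) (h3 : 3 ∣ n₆)
    {s : ℤ} (hs : s = 1 ∨ s = -1) :
    ¬ (W.c₆ / 3 ^ n₆ - 2 * s = 0 ∨ (2 : ℤ) ≤ padicValRat 3 (W.c₆ / 3 ^ n₆ - 2 * s)) := fun hu ↦
  hnot (towerSurj_three_of_surj_of_c₆_residue W hsurj hc₄ hc₆ hΔ hm hj h3 hs hu)

end Residue

/-- **The EXOTIC hypothesis RESTRICTED to the non-residue rows (census digits).**  p251574's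
EXOTIC piece is EQUIVALENT to the same statement on the rows with `c₆/3^{v₃ c₆} ≢ ±2 (mod 9)`
whenever `v₃(j − 1728) = 3`, `v₃ j ≥ 6`, `3 ∣ v₃ c₆` (digit form). [cite: Wuthrich2014, Lemma 20 (p. 399)]
[cite: SerreAbelianLadic1968, Ch. IV §3.4, Lemma 3 (IV-23)] [cite: Serre1972, §5.3] -/
theorem exotic_iff_exotic_of_notC₆ResidueRow :
    (∀ (W : WeierstrassCurve ℚ) [W.IsElliptic] [W.IsGloballyMinimal],
        W.analyticRank = 0 → ClassX4 W 3 → Surj W 3 → 0 ≤ padicValRat 3 W.j → ¬ TypeG W 3 →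
        ¬ (∀ n : ℕ, W.HasSurjectiveModNGaloisRep (3 ^ n : ℕ)) → MissingUpperBoundAt W 3) ↔
    (∀ (W : WeierstrassCurve ℚ) [W.IsElliptic] [W.IsGloballyMinimal],
        W.analyticRank = 0 → ClassX4 W 3 → Surj W 3 → 0 ≤ padicValRat 3 W.j → ¬ TypeG W 3 →
        (∀ (n₄ n₆ nΔ : ℕ), padicValRat 3 W.c₄ = n₄ → padicValRat 3 W.c₆ = n₆ →
          padicValRat 3 W.Δ = nΔ → 2 * n₆ = nΔ + 3 → nΔ + 6 ≤ 3 * n₄ → 3 ∣ n₆ →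
          ∀ s : ℤ, (s = 1 ∨ s = -1) →
            ¬ (W.c₆ / 3 ^ n₆ - 2 * s = 0 ∨ (2 : ℤ) ≤ padicValRat 3 (W.c₆ / 3 ^ n₆ - 2 * s))) →
        ¬ (∀ n : ℕ, W.HasSurjectiveModNGaloisRep (3 ^ n : ℕ)) → MissingUpperBoundAt W 3) := by
  haveI : Fact (Nat.Prime 3) := ⟨Nat.prime_three⟩
  constructor
  · intro h V _ _ hr hX hs hj hG _ hnot
    exact h V hr hX hs hj hG hnot
  · intro h V _ _ hr hX hs hj hG hnot
    exact h V hr hX hs hj hG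
      (fun n₄ n₆ nΔ hc₄ hc₆ hΔ hm hj6 h3 s hsgn ↦
        ClassX4.not_c₆Residue_of_not_towerSurj_three hX hs hnot hc₄ hc₆ hΔ hm hj6 h3 hsgn)
      hnot

/-- **THE END-STATE OF CLASS X4 ON EIGHT NAMED FACTS with the EXOTIC piece OFF THE `c₆`-RESIDUE
ROWS (census digits: `c₆/3^{v₃ c₆} ≢ ±2 mod 9` where `v₃(j − 1728) = 3`, `v₃ j ≥ 6`, `3 ∣ v₃ c₆`)**
— p251574's `…exoticTypeG_noL20` rewritten along `exotic_iff_exotic_of_notC₆ResidueRow`; the form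
rmap-2's engine column 'tower: thm(T-b11A-cubeRoot)' reads (60 of the 341 census cells).  No named
fact beyond the eight; X4 stays CONSTRUCTION-SHAPED; nothing booked.
[cite: Kato2004Asterisque, Thm. 14.5 (3) (p. 236), Thm. 17.4 (3) (p. 273)] [cite: Delbourgo1998, Prop. 4 (p. 144)]
[cite: Wuthrich2014, Lemma 20 (p. 399)] [cite: SilvermanAEC2009, Thm. X.4.14]
[cite: Kim2022StructureSelmer, Conj. 1.10 (PDF p. 8)] [cite: Miller2011LMS, Def. 1.1] [cite: Serre1972, §5.3] -/
theorem x4SharpUnitFree_iff_lower_and_residues_sharp_exoticNotC6Residue_noL20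
    (hCT : exists_casselsTate_pairing (K := ℚ))
    (hKatoS : Kato2004.rankZero_padicValNat_sha_le_sub_localTamagawa_of_additive_potGood_of_imageContainsSL2)
    (hDel : Delbourgo1998.prop4_rankZero_pow_dvd_constantCoeff)
    (hGZK : rank_eq_analyticRank_of_analyticRank_le_one) (hmod : hasEntireLFunction_rat)
    (hmodD : nonempty_modularParametrizationData)
    (hKatoχ : Wuthrich2014.kato_halfEigenCharIdeal_dvd_cyclotomicPrime_of_surjective)
    (hK : Kato2004.charIdeal_dvd_padicLFunctionBranch_component_of_surjective) :
    X4SharpUnitFree ↔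
      (∀ (W : WeierstrassCurve ℚ) [W.IsElliptic] [W.IsGloballyMinimal] (p : ℕ) [Fact p.Prime],
          W.analyticRank = 0 → ClassX4 W p → Surj W p → MissingLowerBoundAt W p) ∧
      (∀ (W : WeierstrassCurve ℚ) [W.IsElliptic] [W.IsGloballyMinimal],
          W.analyticRank = 0 → ClassX4 W 3 → Surj W 3 → 0 ≤ padicValRat 3 W.j → ¬ TypeG W 3 →
          (∀ (n₄ n₆ nΔ : ℕ), padicValRat 3 W.c₄ = n₄ → padicValRat 3 W.c₆ = n₆ →
            padicValRat 3 W.Δ = nΔ → 2 * n₆ = nΔ + 3 → nΔ + 6 ≤ 3 * n₄ → 3 ∣ n₆ →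
            ∀ s : ℤ, (s = 1 ∨ s = -1) →
              ¬ (W.c₆ / 3 ^ n₆ - 2 * s = 0 ∨ (2 : ℤ) ≤ padicValRat 3 (W.c₆ / 3 ^ n₆ - 2 * s))) →
          ¬ (∀ n : ℕ, W.HasSurjectiveModNGaloisRep (3 ^ n : ℕ)) → MissingUpperBoundAt W 3) ∧
      (∀ (W : WeierstrassCurve ℚ) [W.IsElliptic] [W.IsGloballyMinimal] (p : ℕ) [Fact p.Prime],
          W.analyticRank = 0 → ClassX4 W p → Surj W p → 0 ≤ padicValRat p W.j →
          ¬ (TypeGOrd W p ∧ semistabilityIndex W p = 2) →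
          padicValNat p ((W.baseChange ℚ_[p]).localTamagawaNumber ℤ_[p]) + 2 ≤
            padicValNat p W.tamagawaProduct →
          MissingUpperBoundAt W p) ∧
      (∀ (W : WeierstrassCurve ℚ) [W.IsElliptic] [W.IsGloballyMinimal] (p : ℕ) [Fact p.Prime],
          W.analyticRank = 0 → ClassX4 W p → Surj W p → 0 ≤ padicValRat p W.j →
          ¬ (TypeGOrd W p ∧ semistabilityIndex W p = 2) →
          (∃ q : ℚ, shaAn W = (q : ℂ) ∧ Odd (padicValRat p q)) → MissingUpperBoundAt W p) ∧
      (∀ (W : WeierstrassCurve ℚ) [W.IsElliptic] [W.IsGloballyMinimal] (p : ℕ) [Fact p.Prime],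
          W.analyticRank = 0 → ClassX4 W p → Surj W p → 0 ≤ padicValRat p W.j →
          ¬ (TypeGOrd W p ∧ semistabilityIndex W p = 2) →
          (∀ (N : ℕ) [NeZero N] (D : ModularParametrizationData W N), (p : ℤ) ∣ D.maninConstant) →
          MissingUpperBoundAt W p) := by
  rw [x4SharpUnitFree_iff_lower_and_residues_sharp_exoticTypeG_noL20 hCT hKatoS hDel hGZK hmod hmodD
    hKatoχ hK, exotic_iff_exotic_of_notC₆ResidueRow]

end Summit.BirchSwinnertonDyer.Rank1Residual.Additive

end
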